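import Literature.MathematicalPhysics.QuantumFieldTheory.Balaban1983to89.StepInhabited

/-!
# Bałaban's renormalization group for 4-d lattice Yang–Mills — the inductive step, `StepInhabited` PART O.1 (module
# `StepInhabitedMerge`, v1.1): THE OVERHANG BUDGET — the weights of (2.9a) along a merged horizon and the ABSTRACT amortisation
# arithmetic that turns an unweighted amortised overhang bound into the binder `hover` of `Budget.controlsAm_merge` (Part N)

CITATION HEADER (lean-in-tree rule 2026-08-18).  Companion to `Step` / `StepInhabited` (same directory, same audit cell `pub-balaban`,
unit b2b-balaban-f2, FOUNDATIONS 2 — THE INDUCTIVE STEP; react-only addition of f2 gen 19), and like them a TYPED SKELETON with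
kernel-checked bookkeeping, here of ONE passage of the published series: T. Bałaban, *Large field renormalization. II. Localization,
exponentiation, and bounds for the 𝐑 operation*, Commun. Math. Phys. **122**, 355–392 (1989) [Balaban1989LargeFieldII] (cell paper B16;
held `paper:balaban1989-cmp122-large-field-ii`, journal page = PDF page + 354), CASE 2 of the auxiliary induction pp. 386–387 [PDF 32–33],
(1.85)–(1.88), with the weights of (1.80) p. 384 and the flow inequality (2.9) of *Convergent renormalization expansions for lattice gauge
theories*, Commun. Math. Phys. **119**, 243–285 (1988) [Balaban1988Convergent] p. 256.  The passage adjudicated (renders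
`b2b-balaban-ref1/pages/1989-cmp122-large-field-II/1989-cmp122-large-field-II-p032-x2.png`, `…-p033-x2.png`, read as images by the typists
of `Step` Part F, `…B16Absorption` and `…B16Overhang` v1.1, whose headers quote it in full): (1.85) p. 386, *"κ_{j+1}(Z) =
Σ_n(κ_j(Z_j^{(n)}) + 2p₀(g_{j(Z_j^{(n)})})) + Σ_i(γ₀A₁²p₀²(g_{j+1})(d′_{j+1}(Z_{j+1}^{(i)}) + 1) + 2p₀(g_{j+1})) −
O(1)M^dR_{j+1}^{d+1}d′_{j+1}(Z) − 2p₀(g_{j(Z)})"* (`Step.Budget.merge`); p. 387 ll. 8–16, *"The domain S^{K₁}(X) satisfies the conditions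
(i), (ii), in particular it is contained in a cube of the size 100MR_{j+1+K₁}, and it intersects the domains S^{K₁}(Y). It is clear that
applying n₁ times the operation S to the last domain, where n₁ is a rather small number, e.g., n₁ < 10, we obtain the domain S^{K₁+n₁}(Y)
containing S^{K₁+n₁}(X). This implies that S^{n−j−1}(Z) = S^{n−j−1}(Y) for n ≧ j + 1 + K₁ + n₁, and that K ≦ K₂ + n₁ + R_{j+1}. To prove
the statement for κ_{j+1}(Z) we estimate the sum in (1.80): Σ_{n=j+2}^{j+1+K} O(1)M^dR^{d+1}_{j+1}d′_n(S^{n−j−1}(Z)) ≦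
Σ_{n=j+2}^{j+1+K₁+n₁} O(1)M^dR^{d+1}_{j+1}d′_n(S^{n−j−1}(X)) + Σ_{n=j+2}^{j+1+K₂+n₁+R_{j+1}} O(1)M^dR^{d+1}_{j+1}d′_n(S^{n−j−1}(Y)) ≦
κ_{j+1}(X) + κ_{j+1}(Y) + O(1)2(100M)^dR^{d+2}_{j+1} ≦ κ_{j+1}(Z) − 2(1 + β₀)^{−1}p₀(g_{j+1}) + O(1)3(100M)^dR^{d+2}_{j+1} ≦ κ_{j+1}(Z),
(1.88) for p₀ large and γ small enough."*; and (2.9) p. 256 of [Balaban1988Convergent], first member, *"R_n ≦ LR_m"* (render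
`b2b-balaban-ref1/pages/1988-cmp119-convergent-renormalization/1988-cmp119-convergent-renormalization-p014-x2.png`, read as an image by f2
gen 20; stated for the indices of (2.6) p. 255, *"where n > m"*) — used along the flow in the cell's instance `m = j`, written `R_n ≤ LR_j`
OUTSIDE quotation marks in `Step` Part F / `StepInhabited` Part L (typed in raw-sequence form as `Step.Budget.RStepLe`).  B16 is a manuscript
UNDER ADJUDICATION by the audit cell: NOTHING
printed in it is asserted here.  Every declaration below is a `theorem` of elementary real arithmetic / finite-sum bookkeeping, proved
without `sorry` and without new axioms (`#print axioms` ⊆ {propext, Classical.choice, Quot.sound}), over the EXISTING definitions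
`Step.Budget.{Consts, Consts.cost}` (`Step` Part F) and `Step.Budget.RStepLe` (`StepInhabited` Part L), using BY NAME
`Step.Budget.Consts.cost_sum` (Part N) — `Consts.cost_mono` / `Consts.cost_nonneg` are used by the companion O.2, not here.  There is NO `def`: no
notion is introduced.  VALUE = typed skeleton +
gap census (this half feeds the cell's `STEP.md` §11 row O-F4 — the COST half of case 2 — through the companion module of Part O.2), NOT
summit progress.  Prose companion: the cell's `STEP.md` (v11.11: §7.11–§7.13, §11 O-F4; `GAPS.md` C-f2.25; `DIVERGENCE.md` D-f2.22).
Staged byte-identically in the cell package `run/shared/lean/pub/pub-balaban/lean/BalabanYm4/Literature/…`.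

VERSION.  v1 (f2 gen 19) = the five theorems below.  v1.1 (f2 gen 20) = DOCFIX, this header only, every declaration and docstring below
byte-unchanged: (i) the quotation of the first member of (2.9) p. 256 corrected to print's *"R_n ≦ LR_m"* (v1 had the cell's instance
`R_n ≤ LR_j` inside the quotation marks — the cross-read violation V1 of the cell's `GAPS.md` C-ref5-131, also objection O2 of C-pv14-62);
(ii) the BY-NAME list above names `Consts.cost_sum` only (records-only remark R1 of C-ref5-131).  Prose: `STEP.md` v11.12, `GAPS.md` C-f2.26.

WHY TWO LEAF MODULES FOR PART O.  Part O has two halves: O.1 (this module) is abstract arithmetic over `Step`/`StepInhabited` only; O.2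
(the companion leaf module `StepInhabitedMergeIndex`, same namespace) DISCHARGES the geometric binders `hZ`, `hc`, `hover` of
`Budget.controlsAm_merge` BY NAME in the ℤᵈ index model of the operation `S`, and for that CONSUMES the b02 lineage's `B16OverhangN`.
`StepInhabited` imports `Step` only, so that every importer of `Step` can import it without cycles, while the b02 lineage's index-model
modules `B16SProfile` → `B16MergeGeometry` / `B16Absorption` / `B16StoppingRule` → `B16MergeHorizon` → `B16Overhang` → `B16OverhangN`
import `StepInhabited`: O.2 can therefore be appended neither to `StepInhabited` (import cycle) nor to `Step` (frozen at the gate's 200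
000-byte cap since v7.1), and O.1 is kept next to it rather than inside `StepInhabited` so that Part O reads as one unit and the large
import cone of `StepInhabited` is not rebuilt for a bookkeeping appendix.  Both modules are LEAVES (nothing imports them) and modify
nothing; declarations keep the namespace `…Balaban1983to89.Step.Budget` (one vocabulary: `Budget.hover_of_amortised` and O.2's
`Budget.controlsAm_merge_index` next to `Budget.controlsAm_merge`).

WHAT PRINT DOES / WHAT THE CELL FOUND / WHAT PART N TYPED — see the docblock of `StepInhabited` Part N: print obtains (1.80) for a merged
component from (1.85)–(1.86), the inductive assumptions and the sub-additivity (1.88) of the (1.80)-sums with a UNIFORM remainder, resting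
on the absorption sentence of p. 387 ll. 12–15; the b02 lineage refuted that sentence in the ℤᵈ index model `S = collar^[10] ∘ closureIdx`
(`B16Absorption.no_uniform_absorption`, `sum_card_defect`); Part N typed the cell's substitute — NOT PRINTED — an AMORTISED (1.80) with a
multiplicative reserve `θ` (`Budget.ControlsAm`), re-established at an `N`-ary merger (`Budget.controlsAm_merge`) from the printed
exponent gain and cost sub-additivity summed over the merging family plus ONE new geometric hypothesis, the OVERHANG BUDGET `hover` (`Σ_n
cost_n(o_n) ≤ η·Σ_x cost_{j+1}(size x) + (|S|−1)·Fee`, `(1+θ)η ≤ θ`), next to the live/dead decomposition `hZ` and the cost sub-additivity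
`hc`.  WHAT THE b02 LINEAGE THEN PROVED (units b02 gen 11, modules `B16Overhang`, `B16OverhangN`; kernel, index model, CUBE currency —
sizes = numbers of cubes of the iterates, unit weights): the dead overhang profile `o_m = overhangN q S B a m` (the cubes of `S^m(Z)`
outside the iterate of the union of the pieces alive at step `m`) satisfies `hZ` pointwise (`card_Siter_le_alive_add_overhangN`) and,
summed over any horizon `K ≤ N + T` with `2^T ≤ 2(2·treeLen S(Z) + 1)` (the duration–size link `two_pow_find_sub_le₁` of the least
stopping index with memory `N = R_{j+1}`), the AMORTISED bound `Σ_{0<m≤K} o_m ≤ |S|·561^d·j′ + 1122^d·(N+k) + 1122^d·21^d·(2(k+2)/2^k +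
16/2^{j′})·Σ_x #B_x` for every `j′, k` (`sum_overhangN_amortised_touch`, for a TOUCH-connected merger whose members dying before `K`
satisfy condition (i) when they die) — slope as small as desired, fee per piece and per scale of the horizon: (G-AMORT) INHABITED for
every `η > 0`.

WHAT IS TYPED HERE — OURS, NOT BAŁABAN'S (every declaration is labelled accordingly in its docstring).  (O.1) `sum_Ioc_shift` (re-indexing
from absolute scales to steps after the merge scale); the weights of (2.9a) along a merged horizon — `cost_n(s) ≤ L^{d+1}·cost_{j+1}(s)`
for `j+1 < n ≤ K_h` under `RStepLe R L K_h` (`cost_le_pow_mul_cost_succ`, `sum_cost_le_pow_mul_cost_sum`; print's (1.88) has the constant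
weight `O(1)M^dR^{d+1}_{j+1}` outright, the typed (1.80) = `Budget.Controls` carries `R_n`) —; the ABSTRACT amortisation arithmetic
`hover_of_amortised`: an unweighted amortised bound of the b02 lineage's shape `Σ_{0<m≤K_Z} o_m ≤ A·|S| + B + c·Σ_x sz x` with `A, B ≥ 0`
and `L^{d+1}·c ≤ η` yields `hover` with the EXPLICIT fee `Fee = L^{d+1}·cost_{j+1}(2A + B)` for `|S| ≥ 2` (`A·|S| ≤ 2A·(|S| − 1)` is the
only place where two or more pieces are needed — a one-piece family is no merger); and `exists_slope_params`: for all `W, C₀ ≥ 0` and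
every `η > 0` there are `j′, k` with `W·C₀·(2(k+2)/2^k + 16/2^{j′}) ≤ η`, so that EVERY `η > 0` is served and the reserve `θ` (`(1+θ)η ≤
θ`) is cosmetic, at the price of the fee.  (O.2, companion module `StepInhabitedMergeIndex`) instantiates `A = 561^d·j′`, `B =
1122^d·(N+k)`, `c = 1122^d·21^d·(2(k+2)/2^k + 16/2^{j′})` from `B16OverhangN.sum_overhangN_amortised_touch` and feeds
`Budget.controlsAm_merge`.

WHAT IS NOT TYPED AND NOT CLAIMED.  (a) That Bałaban's proof intends any amortised bookkeeping — it prints none (the cell's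
`DIVERGENCE.md` D-f2.21); the printed route (uniform remainder) stays typed as `Step` Part F (`merge_controls`, binder `hsub`), correct
over its binders and uninhabitable along the printed sentence in the index model (`B16Absorption.no_uniform_absorption`).  (b) The located
smallness condition of the amortised route CHANGES relative to print: `Fee` carries `L^{d+1}` (weights via (2.9a) only) and, in O.2's
instance, the constants `2·561^d·j′ + 1122^d·(N+k)` of the index model where print has `O(1)2(100M)^dR^{d+2}_{j+1}`; with `N = R_{j+1}`
and `j′, k = O(log(L^{d+1}/η))` the SHAPE `O_d(1)·L^{d+1}·M^dR_{j+1}^{d+2}` is print's up to the constant — the cell's `SMALLNESS.md`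
(owner r2) records the located row.  (c) Currency and identification readings: O.2's header and the cell's `DIVERGENCE.md` D-f2.22 /
D-b02g9.1.  (d) Summit progress: none — typed skeleton and kernel bookkeeping.

READING NOTES ON `StepInhabited` PART N (docstring items owed since the cross-read of v13, the cell's GAPS C-beta-an3-16 / C-f2.24 (1);
recorded here because the lineage makes no docstring-only landings).  (R1) The Part N docblock quotes the three sums of (1.88) with the
weights `O(1)M^dR_n^{d+1}`; the page (render p033-x2, re-read as an image by f2 gen 18) prints the CONSTANT weight `O(1)M^dR^{d+1}_{j+1}`
in all three sums, as quoted verbatim above — a sub-verbatim slip inside the quotation; no statement is affected (every Part N theorem is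
over the abstract `Budget.Consts.cost n`, which carries `R_n` as (1.80) p. 384 does; the passage from `R_n` to `R_{j+1}`-weights is
(2.9a), O.1 here).  (R2) `controlsAm_K_zero_iff` / the uses of `Finset.Ioc (j+1) (j+1+K)`: for `K = 0` the tail sum is empty and the
amortised statement reads `κ ≥ 0`, exactly as (1.80) does at `j = k` (gloss requested by the cross-reader; nothing to change).
-/

namespace Literature.MathematicalPhysics.QuantumFieldTheory.Balaban1983to89.Step

open Literature.MathematicalPhysics.QuantumFieldTheory.Balaban1983to89

namespace Budget

/-! ## Part O — THE OVERHANG BUDGET WIRED.  O.1: the weights of (2.9a) along a merged horizon and the ABSTRACT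
amortisation arithmetic (needs `Step`/`StepInhabited` only) -/

/-- Re-indexing a (1.80)-type sum from absolute scales `n = c + m` to the steps `m` after the scale `c`:
`Σ_{n=c+1}^{c+K} g(n) = Σ_{m=1}^{K} g(c+m)`. [folklore] -/
theorem sum_Ioc_shift (g : ℕ → ℝ) (c K : ℕ) :
    ∑ n ∈ Finset.Ioc c (c + K), g n = ∑ m ∈ Finset.Ioc 0 K, g (c + m) := by
  induction K with
  | zero => simp
  | succ K ih =>
    rw [Finset.sum_Ioc_succ_top (Nat.zero_le K), ← ih, show c + (K + 1) = c + K + 1 from rfl,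
      Finset.sum_Ioc_succ_top (Nat.le_add_right c K)]

/-- THE WEIGHTS ALONG A MERGED HORIZON against the weight at the merge scale: under (2.9a) [Balaban1988Convergent, (2.9)
p.256] on a horizon `Kh` (`RStepLe`, Part L) the cost at a later scale `n`, `j+1 < n ≤ Kh`, of a non-negative size is at
most `L^{d+1}` times its cost at the scale `j+1`: `O(1)M^dR_n^{d+1}·s ≤ L^{d+1}·O(1)M^dR_{j+1}^{d+1}·s` (the «W ≤ L^{d+1}w_{j+1}» of
the cell's `STEP.md` §7.11 (4); (1.88) p.387 prints the constant weight `O(1)M^dR^{d+1}_{j+1}` outright).  Elementary.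
[cite: Balaban1988Convergent, (2.9) p.256] -/
theorem cost_le_pow_mul_cost_succ (b : Consts) {L : ℝ} {Kh j n : ℕ} (h29 : RStepLe b.R L Kh)
    (hR : ∀ n, 0 ≤ b.R n) (hC : 0 ≤ b.C) (hM : 0 ≤ b.M) (hjn : j + 1 < n) (hn : n ≤ Kh) {s : ℝ} (hs : 0 ≤ s) :
    b.cost n s ≤ L ^ (b.d + 1) * b.cost (j + 1) s := by
  unfold Consts.cost
  have h1 : b.R n ≤ L * b.R (j + 1) := h29 (j + 1) n hjn hn
  have h2 : b.R n ^ (b.d + 1) ≤ (L * b.R (j + 1)) ^ (b.d + 1) := pow_le_pow_left₀ (hR n) h1 _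
  rw [mul_pow] at h2
  have h3 : 0 ≤ b.C * b.M ^ b.d := mul_nonneg hC (pow_nonneg hM _)
  calc b.C * b.M ^ b.d * b.R n ^ (b.d + 1) * s
      ≤ b.C * b.M ^ b.d * (L ^ (b.d + 1) * b.R (j + 1) ^ (b.d + 1)) * s := by
        apply mul_le_mul_of_nonneg_right _ hs
        exact mul_le_mul_of_nonneg_left h2 h3
    _ = L ^ (b.d + 1) * (b.C * b.M ^ b.d * b.R (j + 1) ^ (b.d + 1) * s) := by ring

/-- The weighted sum of a non-negative profile over a merged horizon `(j+1, j+1+K_Z]` inside the (2.9a)-horizon against the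
unweighted one: `Σ_{n=j+2}^{j+1+K_Z} O(1)M^dR_n^{d+1}·o_n ≤ L^{d+1}·O(1)M^dR_{j+1}^{d+1}·Σ_n o_n` (= `B16Overhang.weighted_sum_le`, unit b02,
with the weights named). [cite: Balaban1988Convergent, (2.9) p.256] -/
theorem sum_cost_le_pow_mul_cost_sum (b : Consts) {L : ℝ} {Kh j KZ : ℕ} (h29 : RStepLe b.R L Kh)
    (hR : ∀ n, 0 ≤ b.R n) (hC : 0 ≤ b.C) (hM : 0 ≤ b.M) (hKh : j + 1 + KZ ≤ Kh) (o : ℕ → ℝ) (ho : ∀ n, 0 ≤ o n) :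
    ∑ n ∈ Finset.Ioc (j + 1) (j + 1 + KZ), b.cost n (o n) ≤
      L ^ (b.d + 1) * b.cost (j + 1) (∑ n ∈ Finset.Ioc (j + 1) (j + 1 + KZ), o n) := by
  rw [Consts.cost_sum, Finset.mul_sum]
  apply Finset.sum_le_sum
  intro n hn
  rw [Finset.mem_Ioc] at hn
  exact cost_le_pow_mul_cost_succ b h29 hR hC hM (by omega) (by omega) (ho n)

/-- THE AMORTISATION ARITHMETIC OF THE OVERHANG BUDGET, abstractly (cell bookkeeping, NOT a printed statement): if the UNWEIGHTED
overhang profile `o` of a merger of `|S| ≥ 2` pieces of sizes `sz x ≥ 0` is amortised as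
`Σ_{0<m≤K_Z} o_m ≤ A·|S| + B + c·Σ_x sz x` with `A, B ≥ 0` (b02's `B16OverhangN.sum_overhangN_amortised_touch` has this shape with
`A = 561^d·j′`, `B = 1122^d·(N+k)`, `c = 1122^d·21^d·(2(k+2)/2^k + 16/2^{j′})`), and the slope times the weight ratio is at most
`η` (`L^{d+1}·c ≤ η`), then along the merged horizon inside the (2.9a)-horizon the WEIGHTED overhang satisfies the binder `hover`
of `controlsAm_merge` (Part N): `Σ_{n=j+2}^{j+1+K_Z} cost_n(o_{n−j−1}) ≤ η·Σ_x cost_{j+1}(sz x) + (|S|−1)·Fee` with the EXPLICIT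
fee `Fee = L^{d+1}·cost_{j+1}(2A + B)` (using `|S| ≤ 2(|S|−1)`).  Elementary real arithmetic. [folklore] -/
theorem hover_of_amortised (b : Consts) {ι : Type*} (S : Finset ι) (h2 : 2 ≤ S.card) {L : ℝ} {Kh j KZ : ℕ}
    (h29 : RStepLe b.R L Kh) (hKh : j + 1 + KZ ≤ Kh) (hC : 0 ≤ b.C) (hM : 0 ≤ b.M) (hR : ∀ n, 0 ≤ b.R n)
    (hL : 0 ≤ L) (o : ℕ → ℝ) (ho : ∀ m, 0 ≤ o m) (sz : ι → ℝ) (hsz : ∀ x ∈ S, 0 ≤ sz x) {A B c η : ℝ}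
    (hA : 0 ≤ A) (hB : 0 ≤ B) (hsum : ∑ m ∈ Finset.Ioc 0 KZ, o m ≤ A * S.card + B + c * ∑ x ∈ S, sz x)
    (hslope : L ^ (b.d + 1) * c ≤ η) :
    ∑ n ∈ Finset.Ioc (j + 1) (j + 1 + KZ), b.cost n (o (n - (j + 1))) ≤
      η * (∑ x ∈ S, b.cost (j + 1) (sz x)) + ((S.card : ℝ) - 1) * (L ^ (b.d + 1) * b.cost (j + 1) (2 * A + B)) := by
  -- the weights
  have hw := sum_cost_le_pow_mul_cost_sum b h29 hR hC hM hKh (fun n => o (n - (j + 1))) (fun n => ho _)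
  -- re-indexing
  have hshift : ∑ n ∈ Finset.Ioc (j + 1) (j + 1 + KZ), o (n - (j + 1)) = ∑ m ∈ Finset.Ioc 0 KZ, o m := by
    rw [sum_Ioc_shift (fun n => o (n - (j + 1))) (j + 1) KZ]
    refine Finset.sum_congr rfl fun m _ => ?_
    simp only [Nat.add_sub_cancel_left]
  -- the cost at scale `j+1` is `w ·` the size
  obtain ⟨w, hw0, hcostw⟩ : ∃ w : ℝ, 0 ≤ w ∧ ∀ s, b.cost (j + 1) s = w * s :=
    ⟨b.C * b.M ^ b.d * b.R (j + 1) ^ (b.d + 1),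
      mul_nonneg (mul_nonneg hC (pow_nonneg hM _)) (pow_nonneg (hR _) _), fun s => rfl⟩
  have hLpos : 0 ≤ L ^ (b.d + 1) := pow_nonneg hL _
  have hSsz0 : 0 ≤ ∑ x ∈ S, sz x := Finset.sum_nonneg hsz
  set Ssz : ℝ := ∑ x ∈ S, sz x with hSsz
  have hsumcost : ∑ x ∈ S, b.cost (j + 1) (sz x) = w * Ssz := by
    rw [hSsz, Finset.mul_sum]
    exact Finset.sum_congr rfl fun x _ => hcostw _
  rw [hsumcost, hcostw (2 * A + B)]
  rw [hcostw, hshift] at hw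
  have h2' : (2 : ℝ) ≤ (S.card : ℝ) := by exact_mod_cast h2
  have hcard : (S.card : ℝ) ≤ 2 * ((S.card : ℝ) - 1) := by linarith
  have hm1 : (1 : ℝ) ≤ (S.card : ℝ) - 1 := by linarith
  have step1 : ∑ n ∈ Finset.Ioc (j + 1) (j + 1 + KZ), b.cost n (o (n - (j + 1))) ≤
      L ^ (b.d + 1) * (w * (A * S.card + B + c * Ssz)) :=
    hw.trans (mul_le_mul_of_nonneg_left (mul_le_mul_of_nonneg_left hsum hw0) hLpos)
  have step2 : L ^ (b.d + 1) * (w * (c * Ssz)) ≤ η * (w * Ssz) := by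
    have h := mul_le_mul_of_nonneg_right hslope (mul_nonneg hw0 hSsz0)
    calc L ^ (b.d + 1) * (w * (c * Ssz)) = L ^ (b.d + 1) * c * (w * Ssz) := by ring
      _ ≤ η * (w * Ssz) := h
  have step3 : L ^ (b.d + 1) * (w * (A * S.card + B)) ≤ ((S.card : ℝ) - 1) * (L ^ (b.d + 1) * (w * (2 * A + B))) := by
    have hin : A * S.card + B ≤ ((S.card : ℝ) - 1) * (2 * A + B) := by
      have p1 := mul_le_mul_of_nonneg_left hcard hA
      have p2 := mul_le_mul_of_nonneg_left hm1 hB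
      linarith
    have h := mul_le_mul_of_nonneg_left hin (mul_nonneg hLpos hw0)
    calc L ^ (b.d + 1) * (w * (A * S.card + B)) = L ^ (b.d + 1) * w * (A * S.card + B) := by ring
      _ ≤ L ^ (b.d + 1) * w * (((S.card : ℝ) - 1) * (2 * A + B)) := h
      _ = ((S.card : ℝ) - 1) * (L ^ (b.d + 1) * (w * (2 * A + B))) := by ring
  have e : L ^ (b.d + 1) * (w * (A * S.card + B + c * Ssz)) =
      L ^ (b.d + 1) * (w * (A * S.card + B)) + L ^ (b.d + 1) * (w * (c * Ssz)) := by ring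
  linarith

/-- EVERY `η > 0` IS SERVED: for every weight ratio `W ≥ 0` (here `L^{d+1}`), every constant `C₀ ≥ 0` (here `1122^d·21^d`) and every
`η > 0` there are slope parameters `j′, k` with `W·(C₀·(2(k+2)/2^k + 16/2^{j′})) ≤ η` — the duration–size link makes the slope of the
amortised overhang as small as desired (b02's reading «pick k, j with W·1122^d·21^d·(2(k+2)/2^k + 16/2^j) ≤ η»), so that the reserve
`θ` of the cell's amortised statement (1.80)×(1+θ) is cosmetic: any `θ > 0` with `(1+θ)η ≤ θ` will do, at the price of the fee.
Elementary (`(k+2)/2^k → 0`, `16/2^{j′} → 0`). [folklore] -/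
theorem exists_slope_params {W C₀ η : ℝ} (hW : 0 ≤ W) (hC₀ : 0 ≤ C₀) (hη : 0 < η) :
    ∃ jf k : ℕ, W * (C₀ * (2 * (((k : ℝ) + 2) / 2 ^ k) + 16 / 2 ^ jf)) ≤ η := by
  obtain ⟨n, hn⟩ := exists_nat_gt (20 * W * C₀ / η)
  refine ⟨2 * n, 2 * n, ?_⟩
  have hn0 : (0 : ℝ) ≤ (n : ℝ) := Nat.cast_nonneg n
  have hm0 : (0 : ℝ) < (n : ℝ) + 1 := by linarith
  have h2nN : ∀ m : ℕ, m + 1 ≤ 2 ^ m := by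
    intro m
    induction m with
    | zero => simp
    | succ m ih => rw [pow_succ]; omega
  have h2n : (n : ℝ) + 1 ≤ (2 : ℝ) ^ n := by exact_mod_cast h2nN n
  have hP : ((n : ℝ) + 1) ^ 2 ≤ (2 : ℝ) ^ (2 * n) := by
    rw [pow_mul']
    exact pow_le_pow_left₀ hm0.le h2n 2
  have hPpos : (0 : ℝ) < (2 : ℝ) ^ (2 * n) := by positivity
  have hcast : ((2 * n : ℕ) : ℝ) = 2 * (n : ℝ) := by push_cast; ring
  -- the bracket is at most `20/(n+1)`
  have hm1 : (n : ℝ) + 1 ≤ ((n : ℝ) + 1) ^ 2 := by nlinarith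
  have hbr : (2 * ((2 * (n : ℝ) + 2) / 2 ^ (2 * n)) + 16 / 2 ^ (2 * n)) * ((n : ℝ) + 1) ≤ 20 := by
    have e : (2 * ((2 * (n : ℝ) + 2) / 2 ^ (2 * n)) + 16 / 2 ^ (2 * n)) * ((n : ℝ) + 1)
        = ((4 * ((n : ℝ) + 1) + 16) * ((n : ℝ) + 1)) / 2 ^ (2 * n) := by ring
    rw [e, div_le_iff₀ hPpos]
    nlinarith [hP, hm1, hn0]
  have hbr' : 2 * ((((2 * n : ℕ) : ℝ) + 2) / 2 ^ (2 * n)) + 16 / 2 ^ (2 * n) ≤ 20 / ((n : ℝ) + 1) := by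
    rw [hcast, le_div_iff₀ hm0]
    exact hbr
  have hkey : 20 * W * C₀ ≤ η * ((n : ℝ) + 1) := by
    have h := (div_lt_iff₀ hη).1 hn
    nlinarith [h, hη.le]
  calc W * (C₀ * (2 * ((((2 * n : ℕ) : ℝ) + 2) / 2 ^ (2 * n)) + 16 / 2 ^ (2 * n)))
      ≤ W * (C₀ * (20 / ((n : ℝ) + 1))) :=
        mul_le_mul_of_nonneg_left (mul_le_mul_of_nonneg_left hbr' hC₀) hW
    _ = (20 * W * C₀) / ((n : ℝ) + 1) := by ring
    _ ≤ η := by rw [div_le_iff₀ hm0]; exact hkey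

end Budget

end Literature.MathematicalPhysics.QuantumFieldTheory.Balaban1983to89.Step
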